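import Literature.AlgebraicGeometry.AbelianSchemes.IdealTorsionSubgroupScheme            -- ★ (S-c) p847642: `exists_comp_kerι_eq_iff_forall_mem`, `kerι_comp_i_eq_one`, `exists_baseChange_iso`, `exists_iso_of_forall_iff`
import Literature.AlgebraicGeometry.AbelianSchemes.AbelianSchemeFixedPowBaseChange         -- ★ `RingAction.baseChange`, `RingAction.baseChange_i`
import Literature.AlgebraicGeometry.GroupSchemes.AdmissibleIdealsOfPointSubgroups          -- ★ (UP-ADM) p847824 §3 `EtaleIdealPoints.exists_equiv_subgroup_of_mono`
import HarnessLib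

/-!
# The induced `𝒪`-action on the `𝔭`-torsion layer `A[𝔭] = Ker ψ_P`: existence, ring laws, equivariance of the comparison maps, base change,
# and the stable subgroups of its points ([Conrad2004GrossZagier] §7 Thm. 7.5; [MilneCM2006] §7; [GortzWedhorn2020] Def. 4.45 (2))

Topic `Literature/AlgebraicGeometry/AbelianSchemes`; namespace `Literature.AlgebraicGeometry.AbelianSchemes.AbelianSchemeOver.IdealTorsion` (continues ★
`IdealTorsionSubgroupScheme`, organ (S-c)).  THEOREMS ONLY (no definition, no instance, no notation, no named fact, no `sorry`).  Cell `hodgecm-mathlib`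
(D-0151), programme P6 «MOD» (crux hLiu418 = stmt-HodgeConjecture-24832, `--supports`, count-neutral): organ **(S-c-β)** for the L2 closer `stub_SPEC`
(`F0/P6/L2/LA2-plan/g0/StubDOWN.closer.skeleton.v2.lean` :145; D-line `Cruxes/HLiu418/Lines/F0_P6a_DatumOfInputs.lean` dock rows `β₀ ∕ hβ₀G ∕ hβ₀`):
every ideal-side head of the `sp` chain takes an ENDOMORPHISM FAMILY `β : 𝒪 → (𝒢 ⟶ 𝒢)` intertwined with `ι(a)` (★ `spI` (S1), ★ (E-b4′)
`CanonicalLineAssembly`, ★ SP-SURJ, ★ (UP-ADM) `exists_equiv_admissible`, ★ `AdmissibleIdealTransport` §4 `hcomm`), and the dock PINS `G₀ ↪ A_x̄` with such a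
`β₀`; ★ (S-c) built the kernel `𝒢 = Ker ψ_P ↪ A`, its points clause, finiteness∕flatness, base change and the comparison isomorphisms — this file adds
THE ACTION ON IT and the EQUIVARIANCE of those comparisons.  HC_CM is proved only modulo the printed citations until rung 0 closes; this file is
generic and changes no count.

THE PRINT.  [Conrad2004GrossZagier] §7 (Thm. 7.5) ∕ [MilneCM2006] §7: for an abelian scheme `A∕S` with `ι : 𝒪 → End_S(A)` (`𝒪` commutative) and an
ideal `𝔭 ⊂ 𝒪`, the subgroup scheme `A[𝔭] = ⋂_{a ∈ 𝔭} Ker ι(a)` is `𝒪`-STABLE: `ι(a)` commutes with every `ι(a′)`, `a′ ∈ 𝔭`, so `ι(a)(A[𝔭]) ⊆ A[𝔭]`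
([GortzWedhorn2020] Def. 4.45 (2): the kernel՚s universal property on `T`-points), giving `β(a) : A[𝔭] → A[𝔭]` with `β(a) ∘ incl = incl ∘ ι(a)`,
UNIQUE (the inclusion is a monomorphism), a homomorphism, `β(1) = id`, `β(ab) = β(a)β(b)`, `β(a + b) = β(a) + β(b)`; any morphism `G′ → A[𝔭]` over
`A` from another `𝒪`-equivariant `ι′ : G′ ↪ A` is `𝒪`-equivariant; and `β` commutes with base change `A[𝔭]_{S′} ≅ A_{S′}[𝔭]` ((S-c) §3).

## Contents (`ψ := serreTranslate act E′ hE′ P`, `𝒢 := GroupSchemeKernel.ker ψ`, `kerι ψ : 𝒢 ⟶ A`; `hP : E′P = P`, `h𝔭 : span {P_{k0}} = 𝔭`)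
* §1 THE ACTION: `kerι_comp_i_comp_i_eq_one` (`ι(a)` preserves the `𝔭`-torsion), `exists_comp_kerι_eq_kerι_comp_i` ∕ `existsUnique_…` (the lift `β(a)`,
  unique), `isMonHom_of_comp_kerι_eq_kerι_comp_i`, the ring laws `eq_id_of_comp_kerι_eq_kerι_comp_i_one` ∕ `…_mul` ∕ `…_add` for ANY lifts, and HEAD
  **`exists_action`** (`∃ β : 𝒪 → (𝒢 ⟶ 𝒢)`, intertwined, homomorphic, `β 1 = 𝟙`, `β (ab) = β b ≫ β a`, `β (a+b) = β a * β b` — the dock՚s `β₀ ∕ hβ₀G ∕ hβ₀`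
  shape with ★ `RingAction`՚s laws);
* §2 EQUIVARIANCE OF COMPARISONS: **`comp_eq_comp_of_comp_kerι_eq`** (a morphism `e : G′ ⟶ 𝒢` over `A` intertwines `β′` and `β`), the iso forms
  `hom_equivariant_of_iso` ∕ `inv_equivariant_of_iso` (so the (S-c) §4 iso `exists_iso_of_forall_iff` against the dock pin is `β₀`-equivariant —
  the `hcomm` of ★ `AdmissibleIdealTransport` §4), and **`exists_equivariant_iso_of_forall_iff`** (§4 of (S-c) + equivariance in one head);
* §3 BASE CHANGE: **`pullback_map_comp_eq_comp_of_comp_kerι_eq`** — along the (S-c) §3 iso `e_g : 𝒢_{S′} ≅ Ker ψ_P(A_{S′})`, `(β a)_{S′} ≫ e_g = e_g ≫ β′ a` for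
  the lifts `β′` of `(act.baseChange g).i a = ι(a)_{S′}` (★ `RingAction.baseChange_i`);
* §4 POINTS OVER A FIELD (`S = Spec k`, points `Motives.specOver k k ⟶ _`): **`exists_equiv_subgroups_ker_points`** — {`β`-stable subgroups of `A[𝔭](k)`
  of order `r`} `≃` {subgroups `H ≤ A(k)` of order `r` of `𝔭`-torsion points, `ι`-stable}, membership read through `kerι` (★ (UP-ADM) §3
  `exists_equiv_subgroup_of_mono` + ★ (S-c) (i)); right-hand side = the token shape of ★ (L-q-sub) `IdealTorsionStableSubgroups.exists_equiv_stableSubgroups`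
  (LA1-p04), so the two compose to «subgroups of `A[𝔭](k)` ≃ submodules of `A(k)[𝔭]`»; the three clauses of the D-line carrier `LineOf I y`.

## References
* [Conrad2004GrossZagier] B. Conrad, *Gross–Zagier revisited*, MSRI Publ. 49 (2004), §7 «The Serre tensor construction», Thm. 7.5.
* [MilneCM2006] J. S. Milne, *Complex Multiplication* (2006), §7 «𝔞-multiplications».
* [GortzWedhorn2020] U. Görtz, T. Wedhorn, *Algebraic Geometry I*, 2nd ed. (2020), (4.15) (p. 116), Definition 4.45 (2) (p. 117).
* [Tate1997FiniteFlatGroupSchemes] J. Tate, *Finite flat group schemes* (1997), (3.7).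
-/

noncomputable section

universe u

open CategoryTheory CategoryTheory.Limits AlgebraicGeometry MonoidalCategory CartesianMonoidalCategory
open scoped MonObj CategoryTheory.Obj
open Literature.AlgebraicGeometry.GroupSchemes Literature.AlgebraicGeometry.GroupSchemes.GroupSchemeKernel

namespace Literature.AlgebraicGeometry.AbelianSchemes

namespace AbelianSchemeOver

namespace IdealTorsion

variable {S : Scheme.{u}} {A : AbelianSchemeOver S} {O : Type*} [CommRing O] (act : A.RingAction O) [IsCommMonObj A.X]
  {m : ℕ} (E' : Matrix (Fin m) (Fin m) O) (hE' : E' * E' = E') (P : Matrix (Fin m) (Fin 1) O)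

/-! ## §1 The induced action `β(a) : A[𝔭] → A[𝔭]` -/

section Action

/-- **`ι(a)` PRESERVES THE `𝔭`-TORSION**: `(kerι ≫ ι(a)) ≫ ι(a′) = 1` for `a′ ∈ 𝔭` — `ι(a) ι(a′) = ι(a a′) = ι(a′ a) = ι(a′) ι(a)` (`𝒪` commutative,
★ `RingAction.i_mul`) and `kerι ≫ ι(a′) = 1` (★ (S-c) `kerι_comp_i_eq_one`). [cite: Conrad2004GrossZagier, §7 (Thm. 7.5)] [cite: MilneCM2006, §7] -/
theorem kerι_comp_i_comp_i_eq_one (hP : E' * P = P) {𝔭 : Ideal O} (h𝔭 : Ideal.span (Set.range fun k => P k 0) = 𝔭) (a : O) {a' : O}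
    (ha' : a' ∈ 𝔭) : (kerι (serreTranslate act E' hE' P) ≫ act.i a) ≫ act.i a' = 1 := by
  haveI := act.isMonHom a
  rw [Category.assoc, ← act.i_mul, mul_comm, act.i_mul, ← Category.assoc, kerι_comp_i_eq_one act E' hE' P hP h𝔭 ha', MonObj.one_comp]

/-- **THE LIFT `β(a)` EXISTS**: `ι(a)` restricted to `A[𝔭]` factors through `A[𝔭] ↪ A` (★ (S-c) (i) `exists_comp_kerι_eq_iff_forall_mem` at `t := kerι ≫ ι(a)`).
[cite: GortzWedhorn2020, Definition 4.45 (2), p. 117] [cite: Conrad2004GrossZagier, §7 (Thm. 7.5)] -/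
theorem exists_comp_kerι_eq_kerι_comp_i (hP : E' * P = P) {𝔭 : Ideal O} (h𝔭 : Ideal.span (Set.range fun k => P k 0) = 𝔭) (a : O) :
    ∃ b : ker (serreTranslate act E' hE' P) ⟶ ker (serreTranslate act E' hE' P),
      b ≫ kerι (serreTranslate act E' hE' P) = kerι (serreTranslate act E' hE' P) ≫ act.i a :=
  (exists_comp_kerι_eq_iff_forall_mem act E' hE' P hP h𝔭 _).2 fun _ ha' => kerι_comp_i_comp_i_eq_one act E' hE' P hP h𝔭 a ha'

/-- **THE LIFT IS UNIQUE** (`kerι` is a monomorphism, ★ `ker_hom_ext`). [cite: GortzWedhorn2020, Definition 4.45 (2), p. 117] -/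
theorem existsUnique_comp_kerι_eq_kerι_comp_i (hP : E' * P = P) {𝔭 : Ideal O} (h𝔭 : Ideal.span (Set.range fun k => P k 0) = 𝔭) (a : O) :
    ∃! b : ker (serreTranslate act E' hE' P) ⟶ ker (serreTranslate act E' hE' P),
      b ≫ kerι (serreTranslate act E' hE' P) = kerι (serreTranslate act E' hE' P) ≫ act.i a := by
  obtain ⟨b, hb⟩ := exists_comp_kerι_eq_kerι_comp_i act E' hE' P hP h𝔭 a
  exact ⟨b, hb, fun b' hb' => ker_hom_ext (hb'.trans hb.symm)⟩

/-- **THE LIFT IS A HOMOMORPHISM** (it is the kernel lift of the homomorphism `kerι ≫ ι(a)`, ★ (S-c) `isMonHom_of_comp_kerι_eq`).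
[cite: GortzWedhorn2020, Definition 4.45 (2), p. 117] [cite: Conrad2004GrossZagier, §7 (Thm. 7.5)] -/
theorem isMonHom_of_comp_kerι_eq_kerι_comp_i (hP : E' * P = P) {𝔭 : Ideal O} (h𝔭 : Ideal.span (Set.range fun k => P k 0) = 𝔭) (a : O)
    (b : ker (serreTranslate act E' hE' P) ⟶ ker (serreTranslate act E' hE' P))
    (hb : b ≫ kerι (serreTranslate act E' hE' P) = kerι (serreTranslate act E' hE' P) ≫ act.i a) :
    haveI := isMonHom_serreTranslate act E' hE' P; IsMonHom b := by
  haveI := isMonHom_serreTranslate act E' hE' P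
  haveI := act.isMonHom a
  exact isMonHom_of_comp_kerι_eq act E' hE' P hP h𝔭 (kerι (serreTranslate act E' hE' P) ≫ act.i a)
    (fun a' ha' => kerι_comp_i_comp_i_eq_one act E' hE' P hP h𝔭 a ha') b hb

/-- **`β(1) = 𝟙`** for any lift of `ι(1) = 𝟙` (★ `RingAction.i_one`). [cite: MilneCM2006, §7] -/
theorem eq_id_of_comp_kerι_eq_kerι_comp_i_one (b : ker (serreTranslate act E' hE' P) ⟶ ker (serreTranslate act E' hE' P))
    (hb : b ≫ kerι (serreTranslate act E' hE' P) = kerι (serreTranslate act E' hE' P) ≫ act.i 1) : b = 𝟙 _ :=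
  ker_hom_ext (by rw [hb, act.i_one, Category.comp_id, Category.id_comp])

/-- **`β(ab) = β(b) ≫ β(a)`** for any lifts (★ `RingAction.i_mul`: `ι(ab) = ι(b) ≫ ι(a)`). [cite: MilneCM2006, §7] -/
theorem eq_comp_of_comp_kerι_eq_kerι_comp_i_mul {a a' : O} (b b' bm : ker (serreTranslate act E' hE' P) ⟶ ker (serreTranslate act E' hE' P))
    (hb : b ≫ kerι (serreTranslate act E' hE' P) = kerι (serreTranslate act E' hE' P) ≫ act.i a)
    (hb' : b' ≫ kerι (serreTranslate act E' hE' P) = kerι (serreTranslate act E' hE' P) ≫ act.i a')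
    (hbm : bm ≫ kerι (serreTranslate act E' hE' P) = kerι (serreTranslate act E' hE' P) ≫ act.i (a * a')) : bm = b' ≫ b :=
  ker_hom_ext (by rw [hbm, act.i_mul, Category.assoc, hb, reassoc_of% hb'])

/-- **`β(a + b) = β(a) · β(b)`** (pointwise product of group-scheme endomorphisms) for any lifts (★ `RingAction.i_add`, `kerι` a homomorphism:
Mathlib `MonObj.comp_mul` ∕ `MonObj.mul_comp`). [cite: MilneCM2006, §7] -/
theorem eq_mul_of_comp_kerι_eq_kerι_comp_i_add {a a' : O} (b b' bs : ker (serreTranslate act E' hE' P) ⟶ ker (serreTranslate act E' hE' P))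
    (hb : b ≫ kerι (serreTranslate act E' hE' P) = kerι (serreTranslate act E' hE' P) ≫ act.i a)
    (hb' : b' ≫ kerι (serreTranslate act E' hE' P) = kerι (serreTranslate act E' hE' P) ≫ act.i a')
    (hbs : bs ≫ kerι (serreTranslate act E' hE' P) = kerι (serreTranslate act E' hE' P) ≫ act.i (a + a')) :
    haveI := isMonHom_serreTranslate act E' hE' P; bs = b * b' := by
  haveI := isMonHom_serreTranslate act E' hE' P
  exact ker_hom_ext (by rw [hbs, act.i_add, MonObj.comp_mul, MonObj.mul_comp, hb, hb'])

/-- **HEAD (S-c-β) — THE INDUCED `𝒪`-ACTION ON `A[𝔭]`**: there is `β : 𝒪 → (A[𝔭] ⟶ A[𝔭])` with `β a ≫ kerι = kerι ≫ ι(a)` (the dock row `hβ₀G`), each `β a`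
a homomorphism (`hβ₀`), `β 1 = 𝟙`, `β (ab) = β b ≫ β a`, `β (a + b) = β a · β b` (the laws of ★ `RingAction`).
[cite: Conrad2004GrossZagier, §7 (Thm. 7.5)] [cite: MilneCM2006, §7] [cite: GortzWedhorn2020, Definition 4.45 (2), p. 117] -/
theorem exists_action (hP : E' * P = P) {𝔭 : Ideal O} (h𝔭 : Ideal.span (Set.range fun k => P k 0) = 𝔭) :
    haveI := isMonHom_serreTranslate act E' hE' P
    ∃ β : O → (ker (serreTranslate act E' hE' P) ⟶ ker (serreTranslate act E' hE' P)),
      (∀ a, β a ≫ kerι (serreTranslate act E' hE' P) = kerι (serreTranslate act E' hE' P) ≫ act.i a) ∧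
      (∀ a, IsMonHom (β a)) ∧ β 1 = 𝟙 _ ∧ (∀ a a', β (a * a') = β a' ≫ β a) ∧ ∀ a a', β (a + a') = β a * β a' := by
  haveI := isMonHom_serreTranslate act E' hE' P
  choose β hβ using fun a => exists_comp_kerι_eq_kerι_comp_i act E' hE' P hP h𝔭 a
  exact ⟨β, hβ, fun a => isMonHom_of_comp_kerι_eq_kerι_comp_i act E' hE' P hP h𝔭 a (β a) (hβ a),
    eq_id_of_comp_kerι_eq_kerι_comp_i_one act E' hE' P (β 1) (hβ 1),
    fun a a' => eq_comp_of_comp_kerι_eq_kerι_comp_i_mul act E' hE' P (β a) (β a') (β (a * a')) (hβ a) (hβ a') (hβ _),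
    fun a a' => eq_mul_of_comp_kerι_eq_kerι_comp_i_add act E' hE' P (β a) (β a') (β (a + a')) (hβ a) (hβ a') (hβ _)⟩

end Action

/-! ## §2 Equivariance of the comparison maps into `A[𝔭]` -/

section Equivariance

variable {G' : Over S} (ι' : G' ⟶ A.X)

/-- **MORPHISMS OVER `A` INTO `A[𝔭]` ARE `𝒪`-EQUIVARIANT**: if `e : G′ ⟶ A[𝔭]` lies over `A` (`e ≫ kerι = ι′`), `β′ a` lifts `ι(a)` along `ι′` and `β a` lifts
it along `kerι`, then `β′ a ≫ e = e ≫ β a` (both composites lie over `ι′ ≫ ι(a)`; `kerι` mono). [cite: GortzWedhorn2020, Definition 4.45 (2), p. 117]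
[cite: Conrad2004GrossZagier, §7 (Thm. 7.5)] -/
theorem comp_eq_comp_of_comp_kerι_eq (e : G' ⟶ ker (serreTranslate act E' hE' P)) (he : e ≫ kerι (serreTranslate act E' hE' P) = ι')
    {a : O} (β'a : G' ⟶ G') (hβ' : β'a ≫ ι' = ι' ≫ act.i a)
    (βa : ker (serreTranslate act E' hE' P) ⟶ ker (serreTranslate act E' hE' P))
    (hβ : βa ≫ kerι (serreTranslate act E' hE' P) = kerι (serreTranslate act E' hE' P) ≫ act.i a) :
    β'a ≫ e = e ≫ βa :=
  ker_hom_ext (by rw [Category.assoc, he, hβ', Category.assoc, hβ, ← Category.assoc, he])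

/-- **AN ISOMORPHISM `G′ ≅ A[𝔭]` OVER `A` IS EQUIVARIANT** (hom direction). [cite: GortzWedhorn2020, Definition 4.45 (2), p. 117] -/
theorem hom_equivariant_of_iso (e : G' ≅ ker (serreTranslate act E' hE' P)) (he : e.hom ≫ kerι (serreTranslate act E' hE' P) = ι')
    {a : O} (β'a : G' ⟶ G') (hβ' : β'a ≫ ι' = ι' ≫ act.i a)
    (βa : ker (serreTranslate act E' hE' P) ⟶ ker (serreTranslate act E' hE' P))
    (hβ : βa ≫ kerι (serreTranslate act E' hE' P) = kerι (serreTranslate act E' hE' P) ≫ act.i a) :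
    β'a ≫ e.hom = e.hom ≫ βa :=
  comp_eq_comp_of_comp_kerι_eq act E' hE' P ι' e.hom he β'a hβ' βa hβ

/-- The inverse direction: `β a ≫ e⁻¹ = e⁻¹ ≫ β′ a`. [cite: GortzWedhorn2020, Definition 4.45 (2), p. 117] -/
theorem inv_equivariant_of_iso (e : G' ≅ ker (serreTranslate act E' hE' P)) (he : e.hom ≫ kerι (serreTranslate act E' hE' P) = ι')
    {a : O} (β'a : G' ⟶ G') (hβ' : β'a ≫ ι' = ι' ≫ act.i a)
    (βa : ker (serreTranslate act E' hE' P) ⟶ ker (serreTranslate act E' hE' P))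
    (hβ : βa ≫ kerι (serreTranslate act E' hE' P) = kerι (serreTranslate act E' hE' P) ≫ act.i a) :
    βa ≫ e.inv = e.inv ≫ β'a := by
  rw [Iso.comp_inv_eq, Category.assoc, Iso.eq_inv_comp, hom_equivariant_of_iso act E' hE' P ι' e he β'a hβ' βa hβ]

/-- **HEAD — THE EQUIVARIANT COMPARISON ISO** ((S-c) §4 `exists_iso_of_forall_iff` + §2): a monomorphism `ι′ : G′ ↪ A` with the kernel-of-`𝔭` clause on
`T`-points (the dock pin `ι₀G`, `hkerG₀`) and an intertwined endomorphism family `β′` (`hβ₀G`) is isomorphic to `A[𝔭]` OVER `A` AND `𝒪`-EQUIVARIANTLY, for ANY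
intertwined `β` on `A[𝔭]`. [cite: GortzWedhorn2020, Definition 4.45 (2), p. 117] [cite: Conrad2004GrossZagier, §7 (Thm. 7.5)] [cite: Tate1997FiniteFlatGroupSchemes, (3.7)] -/
theorem exists_equivariant_iso_of_forall_iff (hP : E' * P = P) {𝔭 : Ideal O} (h𝔭 : Ideal.span (Set.range fun k => P k 0) = 𝔭) [Mono ι']
    (hG' : ∀ ⦃T : Over S⦄ (t : T ⟶ A.X), (∃ s : T ⟶ G', s ≫ ι' = t) ↔ ∀ a ∈ 𝔭, t ≫ act.i a = 1)
    (β' : O → (G' ⟶ G')) (hβ' : ∀ a, β' a ≫ ι' = ι' ≫ act.i a)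
    (β : O → (ker (serreTranslate act E' hE' P) ⟶ ker (serreTranslate act E' hE' P)))
    (hβ : ∀ a, β a ≫ kerι (serreTranslate act E' hE' P) = kerι (serreTranslate act E' hE' P) ≫ act.i a) :
    ∃ e : G' ≅ ker (serreTranslate act E' hE' P), e.hom ≫ kerι (serreTranslate act E' hE' P) = ι' ∧
      ∀ a, β' a ≫ e.hom = e.hom ≫ β a := by
  obtain ⟨e, he⟩ := exists_iso_of_forall_iff act E' hE' P hP h𝔭 ι' hG'
  exact ⟨e, he, fun a => hom_equivariant_of_iso act E' hE' P ι' e he (β' a) (hβ' a) (β a) (hβ a)⟩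

end Equivariance

/-! ## §3 The action commutes with base change -/

section BaseChange

variable {S' : Scheme.{u}} (g : S' ⟶ S)

/-- **`β` COMMUTES WITH BASE CHANGE**: along any comparison `e_g : A[𝔭]_{S′} ⟶ A_{S′}[𝔭]` over `A_{S′}` (the (S-c) §3 iso `exists_baseChange_iso`:
`e_g ≫ kerι′ = (kerι)_{S′}`), the base change `(β a)_{S′}` of a lift of `ι(a)` and a lift `β′ a` of `ι(a)_{S′} = (act.baseChange g).i a`
(★ `RingAction.baseChange_i`) correspond: `(β a)_{S′} ≫ e_g = e_g ≫ β′ a` (`kerι′` mono; functoriality of `Over.pullback g`).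
[cite: GortzWedhorn2020, (4.15), p. 116 and Definition 4.45 (2), p. 117] [cite: Conrad2004GrossZagier, §7 (Thm. 7.5)] -/
theorem pullback_map_comp_eq_comp_of_comp_kerι_eq
    (eg : (Over.pullback g).obj (ker (serreTranslate act E' hE' P)) ⟶
      ker (@serreTranslate S' (A.baseChange g) O _ (act.baseChange g) (isCommMonObj_baseChange g) m E' hE' P))
    (heg : eg ≫ kerι _ = (Over.pullback g).map (kerι (serreTranslate act E' hE' P)))
    {a : O} (βa : ker (serreTranslate act E' hE' P) ⟶ ker (serreTranslate act E' hE' P))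
    (hβ : βa ≫ kerι (serreTranslate act E' hE' P) = kerι (serreTranslate act E' hE' P) ≫ act.i a)
    (β'a : ker (@serreTranslate S' (A.baseChange g) O _ (act.baseChange g) (isCommMonObj_baseChange g) m E' hE' P) ⟶
      ker (@serreTranslate S' (A.baseChange g) O _ (act.baseChange g) (isCommMonObj_baseChange g) m E' hE' P))
    (hβ' : β'a ≫ kerι _ = kerι _ ≫ (act.baseChange g).i a) :
    (Over.pullback g).map βa ≫ eg = eg ≫ β'a := by
  haveI := isCommMonObj_baseChange g (A := A)
  apply ker_hom_ext
  have h := congrArg (Over.pullback g).map hβ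
  rw [Functor.map_comp, Functor.map_comp] at h
  rw [Category.assoc, heg, Category.assoc, hβ', ← Category.assoc eg, heg, RingAction.baseChange_i]
  exact h

end BaseChange

/-! ## §4 Points over a field: stable subgroups of `A[𝔭](k)` = stable `𝔭`-torsion subgroups of `A(k)` -/

section Points

variable {k : Type u} [Field k] {A : AbelianSchemeOver (Spec (.of k))} {O : Type*} [CommRing O] (act : A.RingAction O) [IsCommMonObj A.X]
  {m : ℕ} (E' : Matrix (Fin m) (Fin m) O) (hE' : E' * E' = E') (P : Matrix (Fin m) (Fin 1) O)

/-- **HEAD — STABLE SUBGROUPS OF POINTS, UPSTAIRS** (★ (UP-ADM) §3 `exists_equiv_subgroup_of_mono` at `j := kerι`, its image clause rewritten by ★ (S-c) (i)):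
for an intertwined family `β` on `A[𝔭]` and any `r`, {subgroups `H′ ≤ A[𝔭](k)` with `|H′| = r`, `H′ ≫ β a ⊆ H′`} `≃` {subgroups `H ≤ A(k)` with `|H| = r`,
`x ≫ ι(a) = 1` for all `x ∈ H`, `a ∈ 𝔭`, and `H ≫ ι(a) ⊆ H` for all `a`} — the right-hand side in the token shape of ★ (L-q-sub)
`IdealTorsionStableSubgroups.exists_equiv_stableSubgroups` (LA1-p04) at `T := Spec k`, so the two bijections COMPOSE («subgroups of `A[𝔭](k)`» ≃ «stable
`𝔭`-torsion subgroups of `A(k)`» ≃ «submodules of `A(k)[𝔭]`», orders preserved) — membership read through `kerι`; these are the `Nat.card` ∕ ideal-torsion ∕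
stability clauses of the D-line carrier `LineOf I y` (`AlgPoints.map f P = P ≫ f`).  Points = `Motives.specOver k k ⟶ _`, a group under Mathlib՚s scoped `Hom.group`.
[cite: Tate1997FiniteFlatGroupSchemes, (3.7)] [cite: Conrad2004GrossZagier, §7 (Thm. 7.5)] -/
theorem exists_equiv_subgroups_ker_points (hP : E' * P = P) {𝔭 : Ideal O} (h𝔭 : Ideal.span (Set.range fun k => P k 0) = 𝔭)
    (β : O → (ker (serreTranslate act E' hE' P) ⟶ ker (serreTranslate act E' hE' P)))
    (hβ : ∀ a, β a ≫ kerι (serreTranslate act E' hE' P) = kerι (serreTranslate act E' hE' P) ≫ act.i a) (r : ℕ) :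
    haveI := isMonHom_serreTranslate act E' hE' P
    ∃ e : {H' : Subgroup (Motives.specOver k k ⟶ ker (serreTranslate act E' hE' P)) // Nat.card ↥H' = r ∧ ∀ a, ∀ x ∈ H', x ≫ β a ∈ H'} ≃
        {H : Subgroup (Motives.specOver k k ⟶ A.X) //
          Nat.card ↥H = r ∧ (∀ x ∈ H, ∀ a ∈ 𝔭, x ≫ act.i a = 1) ∧ ∀ a, ∀ x ∈ H, x ≫ act.i a ∈ H},
      ∀ H' (x : Motives.specOver k k ⟶ ker (serreTranslate act E' hE' P)),
        (x ≫ kerι (serreTranslate act E' hE' P) ∈ (e H').1 ↔ x ∈ H'.1) := by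
  haveI := isMonHom_serreTranslate act E' hE' P
  haveI := mono_kerι (serreTranslate act E' hE' P)
  obtain ⟨e₀, he₀⟩ := EtaleIdealPoints.exists_equiv_subgroup_of_mono (k := k) (kerι (serreTranslate act E' hE' P)) β act.i hβ r
  -- rewrite the image clause `∃ s, s ≫ kerι = x` as the ideal-torsion clause ((S-c) (i)) and reorder the conjuncts
  have hiff : ∀ H : Subgroup (Motives.specOver k k ⟶ A.X),
      (Nat.card ↥H = r ∧ (∀ a, ∀ x ∈ H, x ≫ act.i a ∈ H) ∧ ∀ x ∈ H, ∃ s : Motives.specOver k k ⟶ ker (serreTranslate act E' hE' P),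
          s ≫ kerι (serreTranslate act E' hE' P) = x) ↔
      (Nat.card ↥H = r ∧ (∀ x ∈ H, ∀ a ∈ 𝔭, x ≫ act.i a = 1) ∧ ∀ a, ∀ x ∈ H, x ≫ act.i a ∈ H) := fun H =>
    ⟨fun h => ⟨h.1, fun x hx => (exists_comp_kerι_eq_iff_forall_mem act E' hE' P hP h𝔭 x).1 (h.2.2 x hx), h.2.1⟩,
      fun h => ⟨h.1, h.2.2, fun x hx => (exists_comp_kerι_eq_iff_forall_mem act E' hE' P hP h𝔭 x).2 (h.2.1 x hx)⟩⟩
  exact ⟨e₀.trans (Equiv.subtypeEquivRight hiff), fun H' x => he₀ H' x⟩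

end Points

end IdealTorsion

end AbelianSchemeOver

end Literature.AlgebraicGeometry.AbelianSchemes

end
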